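import Summits.CriticalPhenomena.CardyFormulaZ2.Theorems.CardyComplexConeSLESixFamiliesGiveCardyCollarDomainsPart7

/-!
# A smooth planar arc as a graph; lattice rotations (helper file 9 for `stub_collarDomains`)

Route `CardyComplexCone`, crux `SLESixFamiliesGiveCardy`, line `collar-touch-sandwich`, STUB E.
Two context-free ingredients of the smooth-mark construction:

* `exists_graph`: a `C²` arc `γ : ℝ → ℂ` through `0` whose velocity `V` at the base parameter has
  `re V ≠ 0` is, near `0`, the graph `im = g (re)` of a `C²` function `g` with `g 0 = 0`,
  `g' 0 = im V / re V` (inverse function theorem for `re ∘ γ`), the parameters being confined to any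
  prescribed neighbourhood of the base parameter;
* `exists_rot_sector`: every nonzero complex number is brought by one of the four lattice rotations
  `e ∈ {1, i, -1, -i}` (acting by `e⁻¹`) into the closed sector `{|re| ≤ im}`; and the fourth-power
  test `im (A⁴) = 4 re A · im A · (re A² - im A²)` detecting the eight lattice/diagonal directions.
-/

noncomputable section

open Set Metric Topology Filter Complex
open Literature.Probability.RandomPlanarGeometry

namespace Summit.CriticalPhenomena.CardyFormulaZ2.Cruxes.SLESixFamiliesGiveCardy.CollarTouchSandwich

/-! ### A smooth arc as a graph over the real axis -/

/-- **A `C²` arc transversal to the imaginary axis is locally a graph over the real axis.**  Given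
`γ : ℝ → ℂ`, `C²` on an open set `N ∋ θ⋆`, with `γ θ⋆ = 0` and velocity `V` at `θ⋆` with `re V ≠ 0`,
there are a `C²` function `g` on `(-r₁, r₁)` with `g 0 = 0`, `g' 0 = im V / re V`, and an open set of
parameters `Θ ∋ θ⋆` inside `N`, such that `im (γ θ) = g (re (γ θ))` for `θ ∈ Θ` and every abscissa of
`(-r₁, r₁)` is `re (γ θ)` for some `θ ∈ Θ`. -/
theorem exists_graph {γ : ℝ → ℂ} {θs : ℝ} {V : ℂ} {N : Set ℝ} (hN : IsOpen N) (hθN : θs ∈ N)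
    (hγ : ∀ θ ∈ N, ContDiffAt ℝ 2 γ θ) (hγ0 : γ θs = 0) (hV : HasDerivAt γ V θs) (hre : V.re ≠ 0) :
    ∃ (g : ℝ → ℝ) (r₁ : ℝ) (Θ : Set ℝ), 0 < r₁ ∧ IsOpen Θ ∧ θs ∈ Θ ∧ Θ ⊆ N ∧
      ContDiffOn ℝ 2 g (Ioo (-r₁) r₁) ∧ g 0 = 0 ∧ HasDerivAt g (V.im / V.re) 0 ∧
      (∀ θ ∈ Θ, g (γ θ).re = (γ θ).im) ∧ (∀ x ∈ Ioo (-r₁) r₁, ∃ θ ∈ Θ, (γ θ).re = x) := by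
  set f : ℝ → ℝ := fun θ => (γ θ).re with hf
  have hf2 : ContDiffAt ℝ 2 f θs := reCLM.contDiff.comp_contDiffAt θs (hγ θs hθN)
  have hfd : HasDerivAt f V.re θs := by
    have h := reCLM.hasFDerivAt.comp_hasDerivAt θs hV
    rw [Complex.reCLM_apply] at h
    exact h
  have hfd' : HasFDerivAt f ((ContinuousLinearEquiv.unitsEquivAut ℝ (Units.mk0 V.re hre) : ℝ →L[ℝ] ℝ)) θs :=
    hfd.hasFDerivAt_equiv hre
  have hn : (2 : WithTop ℕ∞) ≠ 0 := by norm_num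
  set H := hf2.toOpenPartialHomeomorph f hfd' hn with hH
  have hHf : (H : ℝ → ℝ) = f := rfl
  have hsrc : θs ∈ H.source := hf2.mem_toOpenPartialHomeomorph_source hfd' hn
  have hf0 : f θs = 0 := by simp [hf, hγ0]
  -- smoothness of the inverse near `0`
  have hinv : ContDiffAt ℝ 2 H.symm 0 := by
    have := hf2.to_localInverse hfd' hn
    rwa [hf0] at this
  -- restrict the chart to `N`
  set H' := H.restrOpen N hN with hH'
  have hH'f : (H' : ℝ → ℝ) = f := rfl
  have hH's : (H'.symm : ℝ → ℝ) = H.symm := rfl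
  have hsrc' : θs ∈ H'.source := by rw [hH', OpenPartialHomeomorph.restrOpen_source]; exact ⟨hsrc, hθN⟩
  have hsub : H'.source ⊆ N := by rw [hH', OpenPartialHomeomorph.restrOpen_source]; exact inter_subset_right
  have htgt : (0 : ℝ) ∈ H'.target := by rw [← hf0]; exact H'.map_source hsrc'
  have hsymm0 : H'.symm 0 = θs := by rw [← hf0]; exact H'.left_inv hsrc'
  -- a radius inside the target where the inverse is `C²`
  obtain ⟨r₁, hr₁, hball⟩ : ∃ r₁ > 0, ∀ y : ℝ, dist y 0 < r₁ → y ∈ H'.target ∧ ContDiffAt ℝ 2 H.symm y :=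
    Metric.eventually_nhds_iff.1 ((H'.open_target.eventually_mem htgt).and (hinv.eventually (by decide)))
  set g : ℝ → ℝ := fun x => (γ (H.symm x)).im with hg
  refine ⟨g, r₁, H'.source, hr₁, H'.open_source, hsrc', hsub, ?_, ?_, ?_, ?_, ?_⟩
  · intro y hy
    have hy' : dist y 0 < r₁ := by rw [Real.dist_eq, sub_zero]; exact abs_lt.2 ⟨hy.1, hy.2⟩
    obtain ⟨hyt, hyc⟩ := hball y hy'
    have hγy : ContDiffAt ℝ 2 γ (H.symm y) := hγ _ (hsub (H'.map_target hyt))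
    exact (imCLM.contDiff.comp_contDiffAt y (hγy.comp y hyc)).contDiffWithinAt
  · show (γ (H.symm 0)).im = 0
    rw [← hH's, hsymm0, hγ0, Complex.zero_im]
  · have h1 : HasDerivAt H'.symm (V.re)⁻¹ 0 := H'.hasDerivAt_symm htgt hre (by rw [hsymm0]; exact hfd)
    have h2 : HasDerivAt (fun θ => (γ θ).im) V.im (H'.symm 0) := by
      rw [hsymm0]
      have h := imCLM.hasFDerivAt.comp_hasDerivAt θs hV
      rw [Complex.imCLM_apply] at h
      exact h
    have h3 := h2.comp 0 h1
    rw [div_eq_mul_inv]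
    exact h3
  · intro θ hθ
    show (γ (H.symm (f θ))).im = (γ θ).im
    rw [← hH's, ← hH'f, H'.left_inv hθ]
  · intro x hx
    have hx' : dist x 0 < r₁ := by rw [Real.dist_eq, sub_zero]; exact abs_lt.2 ⟨hx.1, hx.2⟩
    obtain ⟨hxt, -⟩ := hball x hx'
    exact ⟨H'.symm x, H'.map_target hxt, H'.right_inv hxt⟩

/-! ### Lattice rotations and sectors -/

/-- The inverses of the four lattice rotations. -/
theorem inv_lattice : (1 : ℂ)⁻¹ = 1 ∧ (I : ℂ)⁻¹ = -I ∧ (-1 : ℂ)⁻¹ = -1 ∧ (-I : ℂ)⁻¹ = I := by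
  refine ⟨inv_one, Complex.inv_I, by norm_num, by rw [inv_neg, Complex.inv_I, neg_neg]⟩

/-- The fourth power of a lattice rotation is `1`. -/
theorem lattice_pow_four {e : ℂ} (he : e = 1 ∨ e = I ∨ e = -1 ∨ e = -I) : e ^ 4 = 1 := by
  rcases he with rfl | rfl | rfl | rfl
  · norm_num
  · exact Complex.I_pow_four
  · norm_num
  · rw [neg_pow, Complex.I_pow_four]; norm_num

/-- A lattice rotation is nonzero and has norm one. -/
theorem lattice_ne_zero {e : ℂ} (he : e = 1 ∨ e = I ∨ e = -1 ∨ e = -I) : e ≠ 0 ∧ ‖e‖ = 1 := by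
  rcases he with rfl | rfl | rfl | rfl <;> simp

/-- **Every nonzero complex number is rotated by a lattice rotation into the sector `{|re| ≤ im}`.** -/
theorem exists_rot_sector {V : ℂ} (hV : V ≠ 0) : ∃ e : ℂ, (e = 1 ∨ e = I ∨ e = -1 ∨ e = -I) ∧
    0 < (e⁻¹ * V).im ∧ |(e⁻¹ * V).re| ≤ (e⁻¹ * V).im := by
  obtain ⟨i1, iI, im1, imI⟩ := inv_lattice
  have hV' : V.re ≠ 0 ∨ V.im ≠ 0 := by
    by_contra h; push Not at h; exact hV (Complex.ext h.1 h.2)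
  rcases le_or_gt |V.re| |V.im| with hab | hab
  · have hb0 : V.im ≠ 0 := by
      intro hb0
      rw [hb0, abs_zero] at hab
      exact hV'.elim (fun h => h (abs_eq_zero.1 (le_antisymm hab (abs_nonneg _)))) (fun h => h hb0)
    rcases lt_or_gt_of_ne hb0 with hb | hb
    · refine ⟨-1, Or.inr (Or.inr (Or.inl rfl)), ?_, ?_⟩ <;> rw [im1, neg_one_mul]
      · rw [Complex.neg_im]; linarith
      · rw [Complex.neg_re, Complex.neg_im, abs_neg]; rwa [abs_of_neg hb] at hab
    · refine ⟨1, Or.inl rfl, ?_, ?_⟩ <;> rw [i1, one_mul]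
      · exact hb
      · rwa [abs_of_pos hb] at hab
  · have ha0 : V.re ≠ 0 := by
      intro ha0; rw [ha0, abs_zero] at hab; linarith [abs_nonneg V.im]
    rcases lt_or_gt_of_ne ha0 with ha | ha
    · refine ⟨I, Or.inr (Or.inl rfl), ?_, ?_⟩ <;> rw [iI, neg_mul]
      · rw [Complex.neg_im, Complex.I_mul_im]; linarith
      · rw [Complex.neg_re, Complex.neg_im, Complex.I_mul_re, Complex.I_mul_im, neg_neg]
        rw [abs_of_neg ha] at hab; exact hab.le
    · refine ⟨-I, Or.inr (Or.inr (Or.inr rfl)), ?_, ?_⟩ <;> rw [imI]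
      · rw [Complex.I_mul_im]; exact ha
      · rw [Complex.I_mul_re, Complex.I_mul_im, abs_neg]
        rw [abs_of_pos ha] at hab; exact hab.le

/-- **The fourth-power test**: `im (A⁴) = 4 re A · im A · (re A² - im A²)`. -/
theorem im_pow_four (A : ℂ) : (A ^ 4).im = 4 * A.re * A.im * (A.re ^ 2 - A.im ^ 2) := by
  have h2 : A ^ 4 = (A * A) * (A * A) := by ring
  simp only [h2, Complex.mul_im, Complex.mul_re]
  ring

/-- In the sector `{|re| ≤ im}`, a number whose fourth power is not real is in GENERAL position:
`0 < |re A| < im A`. -/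
theorem general_position {A : ℂ} (hsec : |A.re| ≤ A.im) (h4 : (A ^ 4).im ≠ 0) :
    0 < |A.re| ∧ |A.re| < A.im := by
  rw [im_pow_four] at h4
  have hre : A.re ≠ 0 := fun h => h4 (by rw [h]; ring)
  refine ⟨abs_pos.2 hre, lt_of_le_of_ne hsec fun h => h4 ?_⟩
  have : A.re ^ 2 = A.im ^ 2 := by rw [← sq_abs, h]
  rw [this]; ring

/-- In the upper half-plane, a number whose fourth power is real is on a LATTICE or DIAGONAL direction:
`re A = 0 ∨ re A = im A ∨ re A = - im A`. -/
theorem lattice_position {A : ℂ} (him : 0 < A.im) (h4 : (A ^ 4).im = 0) :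
    A.re = 0 ∨ A.re = A.im ∨ A.re = -A.im := by
  rw [im_pow_four] at h4
  have : A.re = 0 ∨ A.re ^ 2 - A.im ^ 2 = 0 := by
    rcases mul_eq_zero.1 h4 with h | h
    · rcases mul_eq_zero.1 h with h | h
      · left; rcases mul_eq_zero.1 h with h | h
        · norm_num at h
        · exact h
      · exact absurd h him.ne'
    · exact Or.inr h
  rcases this with h | h
  · exact Or.inl h
  · right
    have : (A.re - A.im) * (A.re + A.im) = 0 := by nlinarith
    rcases mul_eq_zero.1 this with h | h
    · left; linarith
    · right; linarith

end Summit.CriticalPhenomena.CardyFormulaZ2.Cruxes.SLESixFamiliesGiveCardy.CollarTouchSandwich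

end

/-!
# The rotated chart at a plateau point and its monotone level (helper file 10 for `stub_collarDomains`)

Route `CardyComplexCone`, crux `SLESixFamiliesGiveCardy`, line `collar-touch-sandwich`, STUB E.
At a plateau point `M = Λ ζ⋆` we use the rotated, translated chart `Λrot e ζ⋆ ζ = e⁻¹ (Λ ζ - M)`
(`e` a lattice rotation).  When `A = e⁻¹ Λ' ζ⋆` points into the upper half-plane (`im A > 0`), the
inverse function theorem gives a local inverse `H.symm` of `Λrot` near `0` whose level function
`y ↦ re (H.symm (x + i y))` is strictly increasing on a square around `0` (`exists_chart`: its
`y`-derivative is `-im ((e⁻¹ Λ' (H.symm w))⁻¹)`, positive at `w = 0` and nearby by continuity).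
Combined with the half-plane description of the collar domain in logarithmic coordinates (`Part8`)
and ANY function `g` whose graph near `0` lies on the zero level, this yields the epigraph
description `M + e w ∈ collar ↔ g (re w) < im w` (`mem_iff_of_chart`).
-/

noncomputable section

open Set Metric Topology Filter Complex
open Literature.Probability.RandomPlanarGeometry

namespace Summit.CriticalPhenomena.CardyFormulaZ2.Cruxes.SLESixFamiliesGiveCardy.CollarTouchSandwich

variable {D : JordanDomain} (T : D.TubeData)

/-- **The rotated, translated chart** `ζ ↦ e⁻¹ (Λ ζ - Λ ζ⋆)`. -/
def Λrot (e ζs ζ : ℂ) : ℂ := e⁻¹ * (Λ T ζ - Λ T ζs)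

/-- The rotated chart vanishes at the base point. -/
@[simp] theorem Λrot_self (e ζs : ℂ) : Λrot T e ζs ζs = 0 := by simp [Λrot]

/-- Undoing the rotated chart: `Λ ζ = Λ ζ⋆ + e · Λrot ζ`. -/
theorem Λ_eq_of_Λrot {e : ℂ} (he : e ≠ 0) (ζs ζ : ℂ) : Λ T ζ = Λ T ζs + e * Λrot T e ζs ζ := by
  rw [Λrot, ← mul_assoc, mul_inv_cancel₀ he, one_mul, add_sub_cancel]

/-- The derivative of the rotated chart. -/
theorem hasDerivAt_Λrot (e ζs : ℂ) {ζ : ℂ} (hζ : ζ ∈ leftHalf) :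
    HasDerivAt (Λrot T e ζs) (e⁻¹ * deriv (Λ T) ζ) ζ :=
  ((differentiableAt_Λ T hζ).hasDerivAt.sub_const (Λ T ζs)).const_mul e⁻¹

/-- The strict derivative of the rotated chart. -/
theorem hasStrictDerivAt_Λrot (e ζs : ℂ) {ζ : ℂ} (hζ : ζ ∈ leftHalf) :
    HasStrictDerivAt (Λrot T e ζs) (e⁻¹ * deriv (Λ T) ζ) ζ := by
  have h : HasStrictDerivAt (fun x => Λ T x - Λ T ζs) (deriv (Λ T) ζ) ζ := (hasStrictDerivAt_Λ T hζ).sub_const (Λ T ζs)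
  exact HasStrictDerivAt.const_mul e⁻¹ h

/-- The rotated chart is `C^∞` on the left half-plane (real scalars). -/
theorem contDiffAt_Λrot_real (e ζs : ℂ) {ζ : ℂ} (hζ : ζ ∈ leftHalf) {n : WithTop ℕ∞} :
    ContDiffAt ℝ n (Λrot T e ζs) ζ :=
  (contDiffAt_const.mul ((contDiffAt_Λ T hζ).sub contDiffAt_const) : ContDiffAt ℂ n (Λrot T e ζs) ζ).restrict_scalars ℝ

/-- The vertical line through `x`: `y ↦ x + i y`, with derivative `i`. -/
theorem hasDerivAt_vline (x y : ℝ) : HasDerivAt (fun y : ℝ => (x : ℂ) + (y : ℂ) * I) I y := by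
  have h := ((hasDerivAt_id y).ofReal_comp.mul_const I).const_add (x : ℂ)
  simpa using h

/-- The norm of `x + i y` is at most `|x| + |y|`. -/
theorem norm_vline_le (x y : ℝ) : ‖(x : ℂ) + (y : ℂ) * I‖ ≤ |x| + |y| := by
  refine (norm_add_le _ _).trans ?_
  rw [Complex.norm_real, norm_mul, Complex.norm_real, Complex.norm_I, mul_one, Real.norm_eq_abs, Real.norm_eq_abs]

/-- **The local inverse of the rotated chart and its monotone level.**  If `im (e⁻¹ Λ' ζ⋆) > 0` then
for every `ρ > 0` there are a chart `H = Λrot e ζ⋆` (an `OpenPartialHomeomorph`) with source inside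
`leftHalf ∩ ball ζ⋆ ρ` containing `ζ⋆`, `H ζ⋆ = 0`, and `r > 0` such that the ball of radius `2r` lies
in the target and, for every `|x| < r`, the level `y ↦ re (H.symm (x + i y))` is strictly increasing on
`(-r, r)`. -/
theorem exists_chart {e ζs : ℂ} (hζs : ζs ∈ leftHalf) (hA : 0 < (e⁻¹ * deriv (Λ T) ζs).im) {ρ : ℝ} (hρ : 0 < ρ) :
    ∃ (H : OpenPartialHomeomorph ℂ ℂ) (r : ℝ), 0 < r ∧ (H : ℂ → ℂ) = Λrot T e ζs ∧ ζs ∈ H.source ∧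
      H.source ⊆ leftHalf ∩ ball ζs ρ ∧ H ζs = 0 ∧ (∀ w : ℂ, ‖w‖ < 2 * r → w ∈ H.target) ∧
      ∀ x : ℝ, |x| < r → StrictMonoOn (fun y : ℝ => (H.symm ((x : ℂ) + (y : ℂ) * I)).re) (Ioo (-r) r) := by
  set A := e⁻¹ * deriv (Λ T) ζs with hAdef
  have hA0 : A ≠ 0 := fun h => by rw [h, Complex.zero_im] at hA; exact lt_irrefl _ hA
  have hstrict : HasStrictDerivAt (Λrot T e ζs) A ζs := hasStrictDerivAt_Λrot T e ζs hζs
  set H₀ := (hstrict.hasStrictFDerivAt_equiv hA0).toOpenPartialHomeomorph (Λrot T e ζs) with hH₀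
  have hsrc₀ : ζs ∈ H₀.source := (hstrict.hasStrictFDerivAt_equiv hA0).mem_toOpenPartialHomeomorph_source
  have hO : IsOpen (leftHalf ∩ ball ζs ρ) := isOpen_leftHalf.inter isOpen_ball
  set H := H₀.restrOpen (leftHalf ∩ ball ζs ρ) hO with hH
  have hHf : (H : ℂ → ℂ) = Λrot T e ζs := rfl
  have hsrc : ζs ∈ H.source := by
    rw [hH, OpenPartialHomeomorph.restrOpen_source]; exact ⟨hsrc₀, hζs, mem_ball_self hρ⟩
  have hsub : H.source ⊆ leftHalf ∩ ball ζs ρ := by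
    rw [hH, OpenPartialHomeomorph.restrOpen_source]; exact inter_subset_right
  have hH0 : H ζs = 0 := by rw [hHf, Λrot_self]
  have htgt : (0 : ℂ) ∈ H.target := by rw [← hH0]; exact H.map_source hsrc
  have hsymm0 : H.symm 0 = ζs := by rw [← hH0]; exact H.left_inv hsrc
  -- derivative of the inverse at points of the target
  set Ξ' : ℂ → ℂ := fun w => (e⁻¹ * deriv (Λ T) (H.symm w))⁻¹ with hΞ'
  have hderiv : ∀ w ∈ H.target, HasDerivAt H.symm (Ξ' w) w := fun w hw => by
    have hξ : H.symm w ∈ leftHalf := (hsub (H.map_target hw)).1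
    refine H.hasDerivAt_symm hw (mul_ne_zero (inv_ne_zero ?_) (deriv_Λ_ne_zero T hξ)) ?_
    · rintro rfl; rw [inv_zero, zero_mul] at hAdef; exact hA0 hAdef
    · rw [hHf]; exact hasDerivAt_Λrot T e ζs hξ
  -- continuity of the derivative of the inverse at `0`, and positivity of `-im` there
  have hΞc : ContinuousAt Ξ' 0 := by
    have h1 : ContinuousAt (fun w => e⁻¹ * deriv (Λ T) (H.symm w)) 0 :=
      continuousAt_const.mul ((continuousAt_deriv_Λ T (by rw [hsymm0]; exact hζs)).comp_of_eq (H.continuousAt_symm htgt) rfl)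
    exact h1.inv₀ (by simp only [hsymm0]; exact hA0)
  have hp0 : 0 < -(Ξ' 0).im := by
    simp only [hΞ', hsymm0, Complex.inv_im, neg_div, neg_neg]
    exact div_pos hA (Complex.normSq_pos.2 hA0)
  have hpc : ContinuousAt (fun w => -(Ξ' w).im) 0 := (Complex.continuous_im.continuousAt.comp hΞc).neg
  obtain ⟨r₂, hr₂, hball⟩ : ∃ r₂ > 0, ∀ w : ℂ, dist w 0 < r₂ → w ∈ H.target ∧ 0 < -(Ξ' w).im :=
    Metric.eventually_nhds_iff.1 ((H.open_target.eventually_mem htgt).and (hpc.eventually (lt_mem_nhds hp0)))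
  refine ⟨H, r₂ / 2, by positivity, hHf, hsrc, hsub, hH0, fun w hw => (hball w (by rw [dist_zero_right]; linarith)).1,
    fun x hx => ?_⟩
  -- strict monotonicity of the level along vertical lines
  have hin : ∀ y ∈ Ioo (-(r₂ / 2)) (r₂ / 2), ((x : ℂ) + (y : ℂ) * I) ∈ H.target ∧ 0 < -(Ξ' ((x : ℂ) + (y : ℂ) * I)).im :=
    fun y hy => hball _ (by
      rw [dist_zero_right]
      refine (norm_vline_le x y).trans_lt ?_
      have := abs_lt.2 ⟨hy.1, hy.2⟩; linarith)
  have hD : ∀ y ∈ Ioo (-(r₂ / 2)) (r₂ / 2),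
      HasDerivAt (fun y : ℝ => (H.symm ((x : ℂ) + (y : ℂ) * I)).re) (-(Ξ' ((x : ℂ) + (y : ℂ) * I)).im) y := by
    intro y hy
    have h1 := (hderiv _ (hin y hy).1).scomp y (hasDerivAt_vline x y)
    have h2 := reCLM.hasFDerivAt.comp_hasDerivAt y h1
    rw [Complex.reCLM_apply, smul_eq_mul, Complex.I_mul_re] at h2
    exact h2
  refine strictMonoOn_of_deriv_pos (convex_Ioo _ _) (fun y hy => (hD y hy).continuousAt.continuousWithinAt) fun y hy => ?_
  rw [interior_Ioo] at hy
  rw [(hD y hy).deriv]; exact (hin y hy).2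

/-- **The epigraph description from a chart and a level-zero graph.**  With `H`, `r` as in
`exists_chart` at a plateau coordinate `ζ⋆` (`re ζ⋆ = σ₀`) where the collar domain is the half-plane
`{σ₀ < re}` in logarithmic coordinates on `ball ζ⋆ ρ`, every function `g`, continuous at `0` with
`g 0 = 0`, whose graph points `x + i g x` (`|x| < r₃`) lie in the target on the level `re ∘ H.symm = σ₀`,
describes the collar domain near `M = Λ ζ⋆`: `M + e w ∈ collar ↔ g (re w) < im w` for `‖w‖ < r'`. -/
theorem mem_iff_of_chart {R : ConformalRectangle} (T : R.toJordanDomain.TubeData) (P : Profile) {e ζs : ℂ} (he : e ≠ 0)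
    {ρ : ℝ} (hC : ∀ ζ, dist ζ ζs < ρ → ζ ∈ leftHalf ∧ (Λ T ζ ∈ (profileDomain T P).carrier ↔ σ₀ P < ζ.re))
    {H : OpenPartialHomeomorph ℂ ℂ} {r : ℝ} (hr : 0 < r) (hHf : (H : ℂ → ℂ) = Λrot T e ζs)
    (hsub : H.source ⊆ leftHalf ∩ ball ζs ρ) (htgt : ∀ w : ℂ, ‖w‖ < 2 * r → w ∈ H.target)
    (hmono : ∀ x : ℝ, |x| < r → StrictMonoOn (fun y : ℝ => (H.symm ((x : ℂ) + (y : ℂ) * I)).re) (Ioo (-r) r))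
    {g : ℝ → ℝ} (hg : ContinuousAt g 0) (hg0 : g 0 = 0) {r₃ : ℝ} (hr₃ : 0 < r₃)
    (hzero : ∀ x : ℝ, |x| < r₃ → ((x : ℂ) + (g x : ℂ) * I) ∈ H.target ∧ (H.symm ((x : ℂ) + (g x : ℂ) * I)).re = σ₀ P) :
    ∃ r' > 0, ∀ w : ℂ, ‖w‖ < r' → (Λ T ζs + e * w ∈ (profileDomain T P).carrier ↔ g w.re < w.im) := by
  -- `|g x| < r` for small `x`
  obtain ⟨r₄, hr₄, hgr⟩ : ∃ r₄ > 0, ∀ x : ℝ, dist x 0 < r₄ → dist (g x) 0 < r := by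
    have := Metric.continuousAt_iff.1 hg r hr
    simpa only [hg0] using this
  refine ⟨min r (min r₃ r₄), lt_min hr (lt_min hr₃ hr₄), fun w hw => ?_⟩
  have hw1 : ‖w‖ < r := hw.trans_le (min_le_left _ _)
  have hw3 : ‖w‖ < r₃ := hw.trans_le ((min_le_right _ _).trans (min_le_left _ _))
  have hw4 : ‖w‖ < r₄ := hw.trans_le ((min_le_right _ _).trans (min_le_right _ _))
  have hx : |w.re| ≤ ‖w‖ := abs_re_le_norm w
  have hy : |w.im| ≤ ‖w‖ := abs_im_le_norm w
  have hwt : w ∈ H.target := htgt w (by linarith)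
  -- the point of the collar domain in logarithmic coordinates
  set ξ := H.symm w with hξ
  have hξs : ξ ∈ H.source := H.map_target hwt
  have hΛξ : Λ T ξ = Λ T ζs + e * w := by
    have h1 : H ξ = w := H.right_inv hwt
    rw [hHf] at h1
    rw [Λ_eq_of_Λrot T he ζs ξ, h1]
  have hC' := (hC ξ (mem_ball.1 (hsub hξs).2)).2
  rw [← hΛξ, hC']
  -- compare levels along the vertical line through `re w`
  have hwdec : ((w.re : ℂ) + (w.im : ℂ) * I) = w := re_add_im w
  have hmx := hmono w.re (lt_of_le_of_lt hx hw1)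
  have hyI : w.im ∈ Ioo (-r) r := by have := abs_lt.1 (lt_of_le_of_lt hy hw1); exact ⟨this.1, this.2⟩
  have hgI : g w.re ∈ Ioo (-r) r := by
    have := hgr w.re (by rw [dist_zero_right, Real.norm_eq_abs]; exact lt_of_le_of_lt hx hw4)
    rw [dist_zero_right, Real.norm_eq_abs, abs_lt] at this; exact ⟨this.1, this.2⟩
  obtain ⟨-, hz⟩ := hzero w.re (lt_of_le_of_lt hx hw3)
  have key : σ₀ P < ξ.re ↔ (H.symm ((w.re : ℂ) + (g w.re : ℂ) * I)).re < (H.symm ((w.re : ℂ) + (w.im : ℂ) * I)).re := by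
    rw [hz, hwdec]
  rw [key, hmx.lt_iff_lt hgI hyI]

/-- **Main statement of this file** (registered helper stub, arrow style): the local inverse of the
rotated chart with its monotone level. -/
theorem logChart_local_inverse : ∀ {D : JordanDomain} (T : D.TubeData) {e ζs : ℂ}, ζs ∈ leftHalf → 0 < (e⁻¹ * deriv (Λ T) ζs).im → ∀ {ρ : ℝ}, 0 < ρ → ∃ (H : OpenPartialHomeomorph ℂ ℂ) (r : ℝ), 0 < r ∧ (H : ℂ → ℂ) = Λrot T e ζs ∧ ζs ∈ H.source ∧ H.source ⊆ leftHalf ∩ ball ζs ρ ∧ H ζs = 0 ∧ (∀ w : ℂ, ‖w‖ < 2 * r → w ∈ H.target) ∧ ∀ x : ℝ, |x| < r → StrictMonoOn (fun y : ℝ => (H.symm ((x : ℂ) + (y : ℂ) * I)).re) (Ioo (-r) r) :=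
  fun T _ _ hζs hA _ hρ => exists_chart T hζs hA hρ

end Summit.CriticalPhenomena.CardyFormulaZ2.Cruxes.SLESixFamiliesGiveCardy.CollarTouchSandwich

end
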